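import Summits.CriticalPhenomena.PercolationContinuityZ3.Theorems.PercNearOneGluingNoHeavyLowerTailSahiClassTCoreTwoLevel
import Summits.CriticalPhenomena.PercolationContinuityZ3.Theorems.PercNearOneGluingNoHeavyLowerTailSahiClassTCoreJunta
import Summits.CriticalPhenomena.PercolationContinuityZ3.Theorems.PercNearOneGluingNoHeavyLowerTailSahiE3MeetContainment
import Mathlib.Tactic.Linarith
import HarnessLib

/-!
# `NoHeavyLowerTail` (crux stmt-CriticalPhenomena-4575), P2 — the open core, VI: **the HARD RESIDUAL CORE** (P2's residual core ∩ prim-l12-p5's hard core ∩ P3's junta bound)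

Support file (seat `prim-masterthm-p2`, gen 14; `--supports stmt-CriticalPhenomena-4575`).  No definition, no `sorry`, standard axioms.

Two per-triple criteria of OTHER lanes are folded into the residual-core reduction `SahiClassTCube.masterFamilyNonneg_three_of_residualCore`
(`…SahiClassTCoreTwoLevel`): prim-l12-p5's MEET CONTAINMENT (`SahiMeetContainment.sahiE_three_nonneg_of_mul_le`, `…SahiE3MeetContainment`: if one member
contains the intersection of the other two then `E_3 ≥ 0` by Harris — this subsumes a nested pair, a common bottom and a common top member; its complement is
that lane's HARD CORE, `…SahiHardCoreReduction`) and P3's junta slot (`sahiE_three_nonneg_of_card_esupp_le_three`, `…SahiClassTCoreJunta`).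

* `sahiE_three_nonneg_of_inter_subset_one/_two/_zero` — meet containment in the cube vocabulary `sahiE (bernoulliWeight p) 3 (fun j => ind (U j))`, each slot.
* **`masterFamilyNonneg_three_of_hardResidualCore`**, `…_iff_hardResidualCore`, `kahnConjecture_iff_hardResidualCore` — Kahn's Conjecture 5 ⟺ `C_3` on the
  HARD RESIDUAL CORE: triples of increasing events on a finite cube with (1) a coordinate essential to all three members, (2) no canalyzing essential coordinate,
  (3) no private essential coordinate, (4) every member essential on `≥ 4` coordinates, (5) no member containing the intersection of the other two, and (6) at EVERY
  essential coordinate `e`: negative third central moment of the three `1`-sections and no two `1`-sections determined by complementary coordinate sets.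
HONEST FRAMING: a reduction (bookkeeping across lanes); `C_3` on the hard residual core remains OPEN.  The computational sharpening of (4) to `≥ 5`
(P3's `native_decide` certificates) is the companion file `…SahiClassTCoreContainmentFive`. [this work]
-/

noncomputable section

open scoped Classical

namespace Summit.CriticalPhenomena.PercolationContinuityZ3.Theorems

namespace SahiClassTCube

open Finset Function
open Literature.Combinatorics.Sahi2008
open Literature.Probability.LatticeModels (prodBernoulli)
open Literature.Probability.Percolation (DeterminedBy)
open Literature.Probability.Percolation.DecisionTree (ind ind_of_mem ind_of_not_mem ind_nonneg)

variable {κ : Type} [Fintype κ]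

/-- **Meet containment, middle slot**: `U 0 ∩ U 2 ⊆ U 1 ⟹ E_3 ≥ 0` on the cube (prim-l12-p5's `SahiMeetContainment.sahiE_three_nonneg_of_mul_le` for the
log-modular product weight). [this work] -/
theorem sahiE_three_nonneg_of_inter_subset_one (p : κ → unitInterval) (U : Fin 3 → Set (Set κ)) (hU : ∀ j, IsUpperSet (U j))
    (h : U 0 ∩ U 2 ⊆ U 1) : 0 ≤ sahiE (bernoulliWeight p) 3 (fun j => ind (U j)) := by
  -- `1_A ∈ {0,1}`, `1_A ≤ 1`, and `1_{U 0} · 1_{U 2} ≤ 1_{U 1}` pointwise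
  have h01 : ∀ (A : Set (Set κ)) (ω : Set κ), ind A ω = 0 ∨ ind A ω = 1 := fun A ω => by
    by_cases hω : ω ∈ A
    · exact Or.inr (ind_of_mem hω)
    · exact Or.inl (ind_of_not_mem hω)
  have hle : ∀ ω : Set κ, ind (U 1) ω ≤ 1 := fun ω => by rcases h01 (U 1) ω with e | e <;> norm_num [e]
  have hlo : ∀ ω : Set κ, ind (U 0) ω * ind (U 2) ω ≤ ind (U 1) ω := fun ω => by
    by_cases h0 : ω ∈ U 0
    · by_cases h2 : ω ∈ U 2
      · rw [ind_of_mem h0, ind_of_mem h2, ind_of_mem (h ⟨h0, h2⟩), one_mul]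
      · rw [ind_of_not_mem h2, mul_zero]; exact ind_nonneg _ _
    · rw [ind_of_not_mem h0, zero_mul]; exact ind_nonneg _ _
  have key : 0 ≤ sahiE (bernoulliWeight p) 3 ![ind (U 0), ind (U 1), ind (U 2)] :=
    SahiMeetContainment.sahiE_three_nonneg_of_mul_le (isFKGMeasure_bernoulliWeight p) (ind (U 0)) (ind (U 1)) (ind (U 2))
      (h01 (U 0)) (h01 (U 2)) hle (monotone_ind_of_isUpperSet (hU 0)) (monotone_ind_of_isUpperSet (hU 2)) hlo
  rwa [← Pointwise.ind_vec3, vec3_eta] at key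

/-- **Meet containment, last slot**: `U 0 ∩ U 1 ⊆ U 2 ⟹ E_3 ≥ 0`. [this work] -/
theorem sahiE_three_nonneg_of_inter_subset_two (p : κ → unitInterval) (U : Fin 3 → Set (Set κ)) (hU : ∀ j, IsUpperSet (U j))
    (h : U 0 ∩ U 1 ⊆ U 2) : 0 ≤ sahiE (bernoulliWeight p) 3 (fun j => ind (U j)) := by
  rw [← sahiE_three_ind_comp_perm (bernoulliWeight p) (Equiv.swap 1 2) U]
  refine sahiE_three_nonneg_of_inter_subset_one p (fun j => U (Equiv.swap 1 2 j)) (fun j => hU _) ?_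
  have e0 : Equiv.swap (1 : Fin 3) 2 0 = 0 := by decide
  have e1 : Equiv.swap (1 : Fin 3) 2 1 = 2 := by decide
  have e2 : Equiv.swap (1 : Fin 3) 2 2 = 1 := by decide
  simp only [e0, e1, e2]
  exact h

/-- **Meet containment, first slot**: `U 1 ∩ U 2 ⊆ U 0 ⟹ E_3 ≥ 0`. [this work] -/
theorem sahiE_three_nonneg_of_inter_subset_zero (p : κ → unitInterval) (U : Fin 3 → Set (Set κ)) (hU : ∀ j, IsUpperSet (U j))
    (h : U 1 ∩ U 2 ⊆ U 0) : 0 ≤ sahiE (bernoulliWeight p) 3 (fun j => ind (U j)) := by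
  rw [← sahiE_three_ind_comp_perm (bernoulliWeight p) (Equiv.swap 0 1) U]
  refine sahiE_three_nonneg_of_inter_subset_one p (fun j => U (Equiv.swap 0 1 j)) (fun j => hU _) ?_
  have e0 : Equiv.swap (0 : Fin 3) 1 0 = 1 := by decide
  have e1 : Equiv.swap (0 : Fin 3) 1 1 = 0 := by decide
  have e2 : Equiv.swap (0 : Fin 3) 1 2 = 2 := by decide
  simp only [e0, e1, e2]
  exact h

/-- **Kahn's Conjecture 5 ⟸ `C_3` on the HARD RESIDUAL CORE.**  Conditions (1)–(3) are the core of `…SahiClassTCoreReduction`, (4) P3's junta slot, (5) prim-l12-p5's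
hard core (no meet containment, any slot), (6) bnk-2's negative-`κ₃` and no-independent-tops conditions at every essential coordinate. [this work] -/
theorem masterFamilyNonneg_three_of_hardResidualCore
    (hres : ∀ (κ : Type) [Fintype κ] (p : κ → unitInterval) (U : Fin 3 → Set (Set κ)), (∀ j, IsUpperSet (U j)) →
      (∃ x, x ∈ esupp (U 0) ∧ x ∈ esupp (U 1) ∧ x ∈ esupp (U 2)) →
      (∀ j x, x ∈ esupp (U j) → ¬ ({ω : Set κ | x ∈ ω} ⊆ U j) ∧ ¬ (U j ⊆ {ω : Set κ | x ∈ ω})) →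
      (∀ j x, x ∈ esupp (U j) → ∃ j', j' ≠ j ∧ x ∈ esupp (U j')) →
      (∀ j, 4 ≤ (esupp (U j)).card) →
      (¬ (U 1 ∩ U 2 ⊆ U 0) ∧ ¬ (U 0 ∩ U 2 ⊆ U 1) ∧ ¬ (U 0 ∩ U 1 ⊆ U 2)) →
      (∀ (e : κ) (j : Fin 3), e ∈ esupp (U j) →
        thirdCentralMoment (fun X => (prodBernoulli p).real X) (fun i => secAt e true (U i)) < 0 ∧
        ∀ (T : Finset κ) (i i' : Fin 3), i ≠ i' →
          DeterminedBy (secAt e true (U i)) (↑T : Set κ)ᶜ → ¬ DeterminedBy (secAt e true (U i')) (↑T : Set κ)) →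
      0 ≤ sahiE (bernoulliWeight p) 3 (fun j => ind (U j))) :
    MasterFamilyNonneg 3 := by
  refine masterFamilyNonneg_three_of_residualCore (fun κ _ p U hU h1 h2 h3 h6 => ?_)
  by_cases hj : ∃ j, (esupp (U j)).card ≤ 3
  · obtain ⟨j, hj⟩ := hj
    exact sahiE_three_nonneg_of_card_esupp_le_three p U hU hj
  by_cases hc0 : U 1 ∩ U 2 ⊆ U 0
  · exact sahiE_three_nonneg_of_inter_subset_zero p U hU hc0
  by_cases hc1 : U 0 ∩ U 2 ⊆ U 1
  · exact sahiE_three_nonneg_of_inter_subset_one p U hU hc1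
  by_cases hc2 : U 0 ∩ U 1 ⊆ U 2
  · exact sahiE_three_nonneg_of_inter_subset_two p U hU hc2
  push Not at hj
  exact hres κ p U hU h1 h2 h3 (fun j => by have := hj j; omega) ⟨hc0, hc1, hc2⟩ h6

/-- **Kahn's Conjecture 5 ⟺ `C_3` on the hard residual core.** [this work] -/
theorem masterFamilyNonneg_three_iff_hardResidualCore :
    MasterFamilyNonneg 3 ↔
      ∀ (κ : Type) [Fintype κ] (p : κ → unitInterval) (U : Fin 3 → Set (Set κ)), (∀ j, IsUpperSet (U j)) →
        (∃ x, x ∈ esupp (U 0) ∧ x ∈ esupp (U 1) ∧ x ∈ esupp (U 2)) →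
        (∀ j x, x ∈ esupp (U j) → ¬ ({ω : Set κ | x ∈ ω} ⊆ U j) ∧ ¬ (U j ⊆ {ω : Set κ | x ∈ ω})) →
        (∀ j x, x ∈ esupp (U j) → ∃ j', j' ≠ j ∧ x ∈ esupp (U j')) →
        (∀ j, 4 ≤ (esupp (U j)).card) →
        (¬ (U 1 ∩ U 2 ⊆ U 0) ∧ ¬ (U 0 ∩ U 2 ⊆ U 1) ∧ ¬ (U 0 ∩ U 1 ⊆ U 2)) →
        (∀ (e : κ) (j : Fin 3), e ∈ esupp (U j) →
          thirdCentralMoment (fun X => (prodBernoulli p).real X) (fun i => secAt e true (U i)) < 0 ∧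
          ∀ (T : Finset κ) (i i' : Fin 3), i ≠ i' →
            DeterminedBy (secAt e true (U i)) (↑T : Set κ)ᶜ → ¬ DeterminedBy (secAt e true (U i')) (↑T : Set κ)) →
        0 ≤ sahiE (bernoulliWeight p) 3 (fun j => ind (U j)) :=
  ⟨fun h κ _ p U hU _ _ _ _ _ _ => h κ p U hU, masterFamilyNonneg_three_of_hardResidualCore⟩

/-- **`KahnConjecture` ⟺ Kahn's inequality on the hard residual core of cubes.** [this work] -/
theorem kahnConjecture_iff_hardResidualCore :
    KahnConjecture ↔
      ∀ (κ : Type) [Fintype κ] (p : κ → unitInterval) (U : Fin 3 → Set (Set κ)), (∀ j, IsUpperSet (U j)) →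
        (∃ x, x ∈ esupp (U 0) ∧ x ∈ esupp (U 1) ∧ x ∈ esupp (U 2)) →
        (∀ j x, x ∈ esupp (U j) → ¬ ({ω : Set κ | x ∈ ω} ⊆ U j) ∧ ¬ (U j ⊆ {ω : Set κ | x ∈ ω})) →
        (∀ j x, x ∈ esupp (U j) → ∃ j', j' ≠ j ∧ x ∈ esupp (U j')) →
        (∀ j, 4 ≤ (esupp (U j)).card) →
        (¬ (U 1 ∩ U 2 ⊆ U 0) ∧ ¬ (U 0 ∩ U 2 ⊆ U 1) ∧ ¬ (U 0 ∩ U 1 ⊆ U 2)) →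
        (∀ (e : κ) (j : Fin 3), e ∈ esupp (U j) →
          thirdCentralMoment (fun X => (prodBernoulli p).real X) (fun i => secAt e true (U i)) < 0 ∧
          ∀ (T : Finset κ) (i i' : Fin 3), i ≠ i' →
            DeterminedBy (secAt e true (U i)) (↑T : Set κ)ᶜ → ¬ DeterminedBy (secAt e true (U i')) (↑T : Set κ)) →
        0 ≤ sahiE (bernoulliWeight p) 3 (fun j => ind (U j)) := by
  rw [← masterFamilyNonneg_three_iff_kahnConjecture]
  exact masterFamilyNonneg_three_iff_hardResidualCore

end SahiClassTCube

end Summit.CriticalPhenomena.PercolationContinuityZ3.Theorems
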